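import Summits.QuantumFields.YangMills.Theorems.IR.Negative.TypOnsetFloorPoly.Action

/-!
# Crux `IR` (stmt-QuantumFields-19354) — the POLYNOMIAL ROW FLOOR `b⋆_T(β) ≥ c·(β / log β)^{1/7}` for EVERY compact gauge group,
# part 8/10: §4j energy–entropy against a reference filling and its assembly, §4k region counts (sections `Ref`, `RefAssembly`, `Counts`)

Re-homed VERBATIM (statements, proofs, names; namespace `…Cruxes.IR.CruxIdea2g7` ↦ `…Cruxes.IR.RowFloorPoly`) from the crux
workfile `Cruxes/IR/CruxIdea2RowFloorPoly.lean` rev 14 (sha16 742d7312ea0b5c70; author `ym-cruxidea-19354-2` GEN 7; kernel certificate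
`Cruxes/IR/CruxIdea2RowFloorPolyCert.lean` rev 1, sha16 59d3cfe64fab9c7c, gate-elaborated stub-free) per owner R114 (2) (landing seat:
the `ym-19354-disprove-1` lineage, g9), split by its sections into ten ≤ 400-line modules chained by import; the module docstring of
record (history, theorem map, honest framing) is in the headline module `Theorems/IR/Negative/TypOnsetFloorPoly.lean` (part 10/10).
Negative knowledge for stmt-QuantumFields-19354 (`--supports`; closes no stub); not mixing, not a mass gap, nothing about Clay.
-/

set_option autoImplicit false

noncomputable section

open MeasureTheory Filter Topology
open Literature.MathematicalPhysics.QuantumLattice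
open Literature.Probability.LatticeModels
open Summit.QuantumFields.YangMills.Cruxes.IR.Tempered (cellEdges windowCells regionEdges)
open Summit.QuantumFields.YangMills.Cruxes.IR.ShellTempered (windowCellsPlus)
open Summit.QuantumFields.YangMills.Cruxes.IR.OnsetFormats (TypShellCond shellCount)
open Summit.QuantumFields.YangMills.Cruxes.IR.FixedMesh
open Summit.QuantumFields.YangMills.Cruxes.IR.FixedMeshAllG
open Summit.QuantumFields.YangMills.Theorems.FemtoCurvatureTwoPoint.DoublingOfRV (norm_rho_mul_sub_one_le norm_rho_inv_sub_one)
open Summit.QuantumFields.YangMills.Cruxes.IR.HairpinStokes (norm_map_conj_sub_one sub_re_trace_eq_norm_sq)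
open Literature.MathematicalPhysics.QuantumFieldTheory (abs_re_trace_le_sqrt_mul re_trace_map_inv)
open Summit.QuantumFields.YangMills.Theorems.FemtoCurvatureTwoPointC.TorusGauge.TwistLower (norm_rho_mul_sub_rho_mul_le norm_rho_inv_sub_rho_inv)

namespace Summit.QuantumFields.YangMills.Cruxes.IR.RowFloorPoly

section Ref

open scoped Matrix Matrix.Norms.Frobenius
open Literature.MathematicalPhysics.QuantumFieldTheory (haarProbability)

variable {G : Type} [Group G] [TopologicalSpace G] [IsTopologicalGroup G] [CompactSpace G]
  [SecondCountableTopology G] [MeasurableSpace G] [BorelSpace G]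
  {d N : ℕ} (ρ : G →* Matrix (Fin N) (Fin N) ℂ)

omit [SecondCountableTopology G] in
/-- Product of uniform small-ball masses (PROVED): `m₀^{#Λ} ≤ (⊗_Λ Haar)(∏_e Ball_r(ζ₀ e))`. -/
theorem pi_real_ball_ge (Λ : Finset (ZdEdge d)) (ζ₀ : ↥Λ → G)
    {r m₀ : ℝ} (hm₀ : 0 ≤ m₀) (hball : ∀ h : G, m₀ ≤ (haarProbability G).real {g | ‖ρ g - ρ h‖ ≤ r}) :
    m₀ ^ Λ.card ≤ (Measure.pi fun _ : ↥Λ => haarProbability G).real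
      (Set.pi Set.univ fun e : ↥Λ => {g | ‖ρ g - ρ (ζ₀ e)‖ ≤ r}) := by
  rw [measureReal_def, Measure.pi_pi, ENNReal.toReal_prod]
  calc m₀ ^ Λ.card = ∏ _e : ↥Λ, m₀ := by rw [Finset.prod_const, Finset.card_univ, Fintype.card_coe]
    _ ≤ ∏ e : ↥Λ, ((haarProbability G) {g | ‖ρ g - ρ (ζ₀ e)‖ ≤ r}).toReal :=
        Finset.prod_le_prod (fun _ _ => hm₀) fun e _ => by rw [← measureReal_def]; exact hball (ζ₀ e)

/-- **Kernel energy bound WITH A REFERENCE FILLING (PROVED):** for every boundary condition `η`, every reference filling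
`ζ₀ : Λ → G`, radius `r ≥ 0` with uniform small-ball Haar mass `m₀ > 0` (`Haar{‖ρ g − ρ h‖_F ≤ r} ≥ m₀` for all `h`) and `t ≥ 0`:
`E_{γ_Λ(·|η)} A_Λ ≤ A_Λ(ζ₀ ∨ η) + 4√N·#touching·r + (#Λ·log(1/m₀) + t)/β + 2N·#touching·e^{−t}`. -/
theorem ymSpecification_mean_action_le_ref (hρ : Continuous ρ)
    (hρu : ∀ g, ρ g ∈ Matrix.unitaryGroup (Fin N) ℂ) {β : ℝ} (hβ : 0 < β)
    (Λ : Finset (ZdEdge d)) (η : LGConfig d G) (ζ₀ : ↥Λ → G) {r m₀ t : ℝ} (hr : 0 ≤ r) (hm₀ : 0 < m₀)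
    (hball : ∀ h : G, m₀ ≤ (haarProbability G).real {g | ‖ρ g - ρ h‖ ≤ r}) (ht : 0 ≤ t) :
    ∫ U, wilsonBoundaryAction ρ Λ U ∂(ymSpecification ρ β Λ η) ≤
      wilsonBoundaryAction ρ Λ (glueWith Λ ζ₀ η) + 4 * Real.sqrt N * (plaquettesTouching Λ).card * r +
        ((Λ.card : ℝ) * Real.log (1 / m₀) + t) / β + 2 * N * (plaquettesTouching Λ).card * Real.exp (-t) := by
  set π := (Measure.pi fun _ : ↥Λ => haarProbability G).map (glueWith Λ · η) with hπ
  set s := wilsonBoundaryAction ρ Λ (glueWith Λ ζ₀ η) + 4 * Real.sqrt N * (plaquettesTouching Λ).card * r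
    with hs_def
  have hs0 : 0 ≤ s := add_nonneg (wilsonBoundaryAction_nonneg ρ hρu Λ _) (by positivity)
  have hball_sub : (Set.pi Set.univ fun e : ↥Λ => {g | ‖ρ g - ρ (ζ₀ e)‖ ≤ r}) ⊆
      (glueWith Λ · η) ⁻¹' {U | wilsonBoundaryAction ρ Λ U ≤ s} := by
    intro ζ hζ
    simp only [Set.mem_preimage, Set.mem_setOf_eq]
    refine wilsonBoundaryAction_le_of_ball ρ hρu Λ hr (fun e he => ?_) (fun e he => ?_)
    · rw [glueWith_apply_mem Λ ζ η he, glueWith_apply_mem Λ ζ₀ η he]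
      exact (Set.mem_univ_pi.1 hζ) ⟨e, he⟩
    · rw [glueWith_apply_not_mem Λ ζ η he, glueWith_apply_not_mem Λ ζ₀ η he]
  have hmass : m₀ ^ Λ.card ≤ π.real {U | wilsonBoundaryAction ρ Λ U ≤ s} := by
    have hmeas : MeasurableSet {U | wilsonBoundaryAction ρ Λ U ≤ s} :=
      measurableSet_le (continuous_wilsonBoundaryAction ρ hρ Λ).measurable measurable_const
    rw [hπ, measureReal_def, Measure.map_apply (measurable_glueWith Λ η) hmeas, ← measureReal_def]
    exact (pi_real_ball_ge ρ Λ ζ₀ hm₀.le hball).trans (measureReal_mono hball_sub)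
  have hpos : 0 < π.real {U | wilsonBoundaryAction ρ Λ U ≤ s} := lt_of_lt_of_le (pow_pos hm₀ _) hmass
  have hmain := ymSpecification_mean_action_le ρ hρ hρu hβ Λ η hs0 ht hpos
  have hlog : Real.log (1 / π.real {U | wilsonBoundaryAction ρ Λ U ≤ s}) ≤ Λ.card * Real.log (1 / m₀) := by
    have h1 : 1 / π.real {U | wilsonBoundaryAction ρ Λ U ≤ s} ≤ 1 / m₀ ^ Λ.card :=
      one_div_le_one_div_of_le (pow_pos hm₀ _) hmass
    calc Real.log (1 / π.real {U | wilsonBoundaryAction ρ Λ U ≤ s}) ≤ Real.log (1 / m₀ ^ Λ.card) :=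
          Real.log_le_log (one_div_pos.2 hpos) h1
      _ = Λ.card * Real.log (1 / m₀) := by rw [← one_div_pow, Real.log_pow]
  have hdiv : (Real.log (1 / π.real {U | wilsonBoundaryAction ρ Λ U ≤ s}) + t) / β ≤
      ((Λ.card : ℝ) * Real.log (1 / m₀) + t) / β := by gcongr
  linarith [hmain, hdiv]


open Summit.QuantumFields.YangMills.Theorems.FreeEnergyLogCoefficient (dimE exists_haar_gball_ge)

omit [SecondCountableTopology G] in
/-- Haar balls around any centre are at least as heavy as the ball around `1` (left invariance + unitary invariance of
the Frobenius norm; PROVED). -/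
theorem haar_ball_one_le_ball (hρu : ∀ g, ρ g ∈ Matrix.unitaryGroup (Fin N) ℂ) (h : G) (r : ℝ) :
    haarProbability G {g | ‖ρ g - 1‖ ≤ r} ≤ haarProbability G {g | ‖ρ g - ρ h‖ ≤ r} := by
  haveI : (haarProbability G).IsMulLeftInvariant := by unfold haarProbability; infer_instance
  have hsub : {g : G | ‖ρ g - 1‖ ≤ r} ⊆ (fun g => h * g) ⁻¹' {g | ‖ρ g - ρ h‖ ≤ r} := by
    intro g hg
    simp only [Set.mem_preimage, Set.mem_setOf_eq] at hg ⊢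
    have e : ρ (h * g) - ρ h = ρ h * (ρ g - 1) := by rw [map_mul, mul_sub, mul_one]
    rw [e, Matrix.frobenius_norm_unitaryGroup_mul ⟨ρ h, hρu h⟩]
    exact hg
  calc haarProbability G {g | ‖ρ g - 1‖ ≤ r} ≤ haarProbability G ((fun g => h * g) ⁻¹' {g | ‖ρ g - ρ h‖ ≤ r}) :=
        measure_mono hsub
    _ = haarProbability G {g | ‖ρ g - ρ h‖ ≤ r} := measure_preimage_mul _ _ _

omit [SecondCountableTopology G] in
/-- **Uniform small-ball Haar mass (PROVED from the tree's `exists_haar_gball_ge`, Chatterjee Cor. 6.3):** for a faithful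
unitary `ρ` there is `C > 0` with `Haar{g | ‖ρ g − ρ h‖_F ≤ δ} ≥ C δ^{dimE ρ}` for all centres `h` and `0 < δ ≤ 1`. -/
theorem exists_haar_ball_center_ge (hρ : Continuous ρ) (hρi : Function.Injective ρ)
    (hρu : ∀ g, ρ g ∈ Matrix.unitaryGroup (Fin N) ℂ) :
    ∃ C : ℝ, 0 < C ∧ ∀ δ : ℝ, 0 < δ → δ ≤ 1 → ∀ h : G,
      C * δ ^ dimE ρ ≤ (haarProbability G).real {g | ‖ρ g - ρ h‖ ≤ δ} := by
  obtain ⟨C, hC, hball⟩ := exists_haar_gball_ge ρ hρ hρi hρu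
  refine ⟨C, hC, fun δ hδ hδ1 h => ?_⟩
  have h1 := (hball δ hδ hδ1).trans (haar_ball_one_le_ball ρ hρu h δ)
  rw [measureReal_def]
  exact (ENNReal.ofReal_le_iff_le_toReal (measure_ne_top _ _)).1 h1



end Ref

section RefAssembly

open scoped Matrix Matrix.Norms.Frobenius
open Literature.MathematicalPhysics.QuantumFieldTheory (haarProbability wilsonMeasure GaugeConfig isProbabilityMeasure_wilsonMeasure)
open Summit.QuantumFields.YangMills.Theorems.TunedSequenceExists.Negative.Freezing (integrable_of_continuous)
open Summit.QuantumFields.YangMills.Theorems.FreeEnergyLogCoefficient (dimE exists_haar_gball_ge)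

variable {G : Type} [Group G] [TopologicalSpace G] [IsTopologicalGroup G] [CompactSpace G]
  [SecondCountableTopology G] [MeasurableSpace G] [BorelSpace G]
  {N : ℕ} (ρ : G →* Matrix (Fin N) (Fin N) ℂ)

/-- **The kernel-mean action against a reference filling, with the rates (PROVED):** there is `K = K(ρ)` such that for
`β ≥ 3` and EVERY `b, V` and every reference filling `ζ₀` of `Λ = rowRegion b n`:
`kernelAction V ≤ A_Λ(ζ₀ ∨ σ'_V) + K · (#Λ + #touching(Λ) + 1) · log β / β`
(`ymSpecification_mean_action_le_ref` at `r = 1/β`, `m₀ = C β^{−dimE ρ}`, `t = log β`). -/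
theorem kernelAction_le_ref (hρ : Continuous ρ) (hρi : Function.Injective ρ)
    (hρu : ∀ g, ρ g ∈ Matrix.unitaryGroup (Fin N) ℂ) (n : ℕ) (k₀ : G) :
    ∃ K : ℝ, 0 < K ∧ ∀ β : ℝ, 3 ≤ β → ∀ (b : ℕ) (V : GaugeConfig 4 (2 * ((2 * n + 2) * b + 1) + 1) G)
      (ζ₀ : ↥(rowRegion b n) → G),
      kernelAction ρ β b n k₀ V ≤
        wilsonBoundaryAction ρ (rowRegion b n) (glueWith (rowRegion b n) ζ₀
          (twistΦ b (comb b ((2 * n + 2) * b + 1) k₀) (torusLift (2 * ((2 * n + 2) * b + 1) + 1) V))) +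
        K * ((rowRegion b n).card + (plaquettesTouching (rowRegion b n)).card + 1) * (Real.log β / β) := by
  obtain ⟨C, hC, hball⟩ := exists_haar_ball_center_ge ρ hρ hρi hρu
  refine ⟨4 * Real.sqrt N + 2 * N + dimE ρ + |Real.log C| + 1, by positivity, fun β hβ b V ζ₀ => ?_⟩
  have hβ0 : 0 < β := by linarith
  have hβ1 : 1 ≤ β := by linarith
  have hlog1 : 1 ≤ Real.log β :=
    ((Real.le_log_iff_exp_le (by linarith)).2 (by have := Real.exp_one_lt_d9; norm_num at this; linarith) : 1 ≤ Real.log β)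
  have hL0 : 0 < Real.log β / β := div_pos (by linarith) hβ0
  have hr : (0 : ℝ) ≤ 1 / β := by positivity
  have hδ : (0 : ℝ) < 1 / β := by positivity
  have hδ1 : 1 / β ≤ 1 := by rw [div_le_one hβ0]; exact hβ1
  have hm₀pos : 0 < C * (1 / β) ^ dimE ρ := by positivity
  have hballr : ∀ h : G, C * (1 / β) ^ dimE ρ ≤ (haarProbability G).real {g | ‖ρ g - ρ h‖ ≤ 1 / β} :=
    fun h => hball _ hδ hδ1 h
  have ht0 : 0 ≤ Real.log β := by linarith
  have key := ymSpecification_mean_action_le_ref ρ hρ hρu hβ0 (rowRegion b n)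
    (twistΦ b (comb b ((2 * n + 2) * b + 1) k₀) (torusLift (2 * ((2 * n + 2) * b + 1) + 1) V)) ζ₀ hr hm₀pos hballr ht0
  have hT0 : (0 : ℝ) ≤ (plaquettesTouching (rowRegion b n)).card := by positivity
  have hΛc0 : (0 : ℝ) ≤ (rowRegion b n).card := by positivity
  have hD0 : (0 : ℝ) ≤ dimE ρ := by positivity
  have hexp : Real.exp (-Real.log β) = 1 / β := by rw [Real.exp_neg, Real.exp_log hβ0, one_div]
  have hlogm : Real.log (1 / (C * (1 / β) ^ dimE ρ)) ≤ ((dimE ρ : ℝ) + |Real.log C|) * Real.log β := by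
    have e : Real.log (1 / (C * (1 / β) ^ dimE ρ)) = (dimE ρ : ℝ) * Real.log β - Real.log C := by
      rw [one_div, Real.log_inv, Real.log_mul hC.ne' (pow_ne_zero _ hδ.ne'), Real.log_pow, one_div, Real.log_inv]
      ring
    rw [e]
    have h1 : -Real.log C ≤ |Real.log C| * Real.log β := by
      calc -Real.log C ≤ |Real.log C| := neg_le_abs _
        _ = |Real.log C| * 1 := (mul_one _).symm
        _ ≤ |Real.log C| * Real.log β := mul_le_mul_of_nonneg_left hlog1 (abs_nonneg _)
    linarith
  have h1β : 1 / β ≤ Real.log β / β := div_le_div_of_nonneg_right hlog1 hβ0.le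
  have e1 : 4 * Real.sqrt N * ((plaquettesTouching (rowRegion b n)).card : ℝ) * (1 / β) ≤
      4 * Real.sqrt N * ((plaquettesTouching (rowRegion b n)).card : ℝ) * (Real.log β / β) :=
    mul_le_mul_of_nonneg_left h1β (by positivity)
  have e2 : (((rowRegion b n).card : ℝ) * Real.log (1 / (C * (1 / β) ^ dimE ρ)) + Real.log β) / β ≤
      (((rowRegion b n).card : ℝ) * ((dimE ρ : ℝ) + |Real.log C|) + 1) * (Real.log β / β) := by
    have h2 : ((rowRegion b n).card : ℝ) * Real.log (1 / (C * (1 / β) ^ dimE ρ)) + Real.log β ≤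
        (((rowRegion b n).card : ℝ) * ((dimE ρ : ℝ) + |Real.log C|) + 1) * Real.log β := by
      have := mul_le_mul_of_nonneg_left hlogm hΛc0
      linarith
    calc (((rowRegion b n).card : ℝ) * Real.log (1 / (C * (1 / β) ^ dimE ρ)) + Real.log β) / β
        = (((rowRegion b n).card : ℝ) * Real.log (1 / (C * (1 / β) ^ dimE ρ)) + Real.log β) * (1 / β) := by ring
      _ ≤ ((((rowRegion b n).card : ℝ) * ((dimE ρ : ℝ) + |Real.log C|) + 1) * Real.log β) * (1 / β) :=
          mul_le_mul_of_nonneg_right h2 (by positivity)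
      _ = (((rowRegion b n).card : ℝ) * ((dimE ρ : ℝ) + |Real.log C|) + 1) * (Real.log β / β) := by ring
  have e3 : 2 * N * ((plaquettesTouching (rowRegion b n)).card : ℝ) * Real.exp (-Real.log β) ≤
      2 * N * ((plaquettesTouching (rowRegion b n)).card : ℝ) * (Real.log β / β) := by
    rw [hexp]; exact mul_le_mul_of_nonneg_left h1β (by positivity)
  have hcoef : 4 * Real.sqrt N * ((plaquettesTouching (rowRegion b n)).card : ℝ) +
      (((rowRegion b n).card : ℝ) * ((dimE ρ : ℝ) + |Real.log C|) + 1) +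
      2 * N * ((plaquettesTouching (rowRegion b n)).card : ℝ) ≤
      (4 * Real.sqrt N + 2 * N + dimE ρ + |Real.log C| + 1) *
        (((rowRegion b n).card : ℝ) + (plaquettesTouching (rowRegion b n)).card + 1) := by
    have hN0 : (0 : ℝ) ≤ N := Nat.cast_nonneg N
    have hs0 : (0 : ℝ) ≤ Real.sqrt N := Real.sqrt_nonneg _
    have ha0 : (0 : ℝ) ≤ |Real.log C| := abs_nonneg _
    nlinarith [mul_nonneg hT0 hD0, mul_nonneg hT0 ha0, mul_nonneg hΛc0 hs0, mul_nonneg hΛc0 hN0,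
      mul_nonneg hs0 hΛc0, hT0, hΛc0, hD0]
  have hfin := mul_le_mul_of_nonneg_right hcoef hL0.le
  have hsum : 4 * Real.sqrt N * ((plaquettesTouching (rowRegion b n)).card : ℝ) * (Real.log β / β) +
      (((rowRegion b n).card : ℝ) * ((dimE ρ : ℝ) + |Real.log C|) + 1) * (Real.log β / β) +
      2 * N * ((plaquettesTouching (rowRegion b n)).card : ℝ) * (Real.log β / β) ≤
      (4 * Real.sqrt N + 2 * N + dimE ρ + |Real.log C| + 1) *
        (((rowRegion b n).card : ℝ) + (plaquettesTouching (rowRegion b n)).card + 1) * (Real.log β / β) := by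
    have e : 4 * Real.sqrt N * ((plaquettesTouching (rowRegion b n)).card : ℝ) * (Real.log β / β) +
      (((rowRegion b n).card : ℝ) * ((dimE ρ : ℝ) + |Real.log C|) + 1) * (Real.log β / β) +
      2 * N * ((plaquettesTouching (rowRegion b n)).card : ℝ) * (Real.log β / β) =
      (4 * Real.sqrt N * ((plaquettesTouching (rowRegion b n)).card : ℝ) +
      (((rowRegion b n).card : ℝ) * ((dimE ρ : ℝ) + |Real.log C|) + 1) +
      2 * N * ((plaquettesTouching (rowRegion b n)).card : ℝ)) * (Real.log β / β) := by ring
    rw [e]; exact hfin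
  unfold kernelAction
  linarith [key, e1, e2, e3, hsum]

set_option maxHeartbeats 400000 in
/-- **K1‴ ⇐ (reference-filling energy in μ-mean) ∧ (region counts) (PROVED):** the final assembly — integrate
`kernelAction_le_ref` against `μ_{L_b,β}`. -/
theorem integral_kernelAction_le_of_ref (hρ : Continuous ρ) (hρi : Function.Injective ρ)
    (hρu : ∀ g, ρ g ∈ Matrix.unitaryGroup (Fin N) ℂ) {n : ℕ} {k₀ : G}
    (hcount : ∃ C₀ : ℝ, ∀ b : ℕ, 1 ≤ b →
      ((rowRegion b n).card : ℝ) + (plaquettesTouching (rowRegion b n)).card + 1 ≤ C₀ * (b : ℝ) ^ 4)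
    (href : ∃ C₁ : ℝ, 0 < C₁ ∧ ∃ β₂ : ℝ, ∀ β : ℝ, β₂ ≤ β → ∀ b : ℕ, 1 ≤ b →
      ∃ ζ₀ : GaugeConfig 4 (2 * ((2 * n + 2) * b + 1) + 1) G → (↥(rowRegion b n) → G),
        Measurable (fun V => wilsonBoundaryAction ρ (rowRegion b n) (glueWith (rowRegion b n) (ζ₀ V)
          (twistΦ b (comb b ((2 * n + 2) * b + 1) k₀) (torusLift (2 * ((2 * n + 2) * b + 1) + 1) V)))) ∧
        ∫ V, wilsonBoundaryAction ρ (rowRegion b n) (glueWith (rowRegion b n) (ζ₀ V)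
          (twistΦ b (comb b ((2 * n + 2) * b + 1) k₀) (torusLift (2 * ((2 * n + 2) * b + 1) + 1) V)))
          ∂(wilsonMeasure (d := 4) (L := 2 * ((2 * n + 2) * b + 1) + 1) ρ β) ≤ C₁ * (b : ℝ) ^ 5 * (Real.log β / β)) :
    ∃ C : ℝ, 0 < C ∧ ∃ β₁ : ℝ, ∀ β : ℝ, β₁ ≤ β → ∀ b : ℕ, 1 ≤ b →
      ∫ V, kernelAction ρ β b n k₀ V ∂(wilsonMeasure (d := 4) (L := 2 * ((2 * n + 2) * b + 1) + 1) ρ β) ≤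
        C * (b : ℝ) ^ 5 * (Real.log β / β) := by
  obtain ⟨K, hK, hpt⟩ := kernelAction_le_ref ρ hρ hρi hρu n k₀
  obtain ⟨C₀, hC₀⟩ := hcount
  obtain ⟨C₁, hC₁, β₂, href⟩ := href
  have hC₀1 : 1 ≤ C₀ := by
    have h := hC₀ 1 le_rfl
    have h0 : (0 : ℝ) ≤ ((rowRegion 1 n).card : ℝ) + (plaquettesTouching (rowRegion 1 n)).card := by positivity
    simp only [Nat.cast_one, one_pow, mul_one] at h
    linarith
  have hC₀0 : 0 ≤ C₀ := by linarith
  refine ⟨C₁ + K * C₀, by positivity, max β₂ 3, fun β hβ b hb => ?_⟩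
  have hβ2 : β₂ ≤ β := (le_max_left _ _).trans hβ
  have hβ3 : (3 : ℝ) ≤ β := (le_max_right _ _).trans hβ
  have hβ0 : 0 < β := by linarith
  have hL0 : 0 ≤ Real.log β / β := div_nonneg (by linarith [((Real.le_log_iff_exp_le (by linarith)).2 (by have := Real.exp_one_lt_d9; norm_num at this; linarith) : 1 ≤ Real.log β)]) hβ0.le
  obtain ⟨ζ₀, hmeas, hint⟩ := href β hβ2 b hb
  haveI : IsProbabilityMeasure (wilsonMeasure (d := 4) (L := 2 * ((2 * n + 2) * b + 1) + 1) ρ β) :=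
    isProbabilityMeasure_wilsonMeasure ρ hρ β
  have hb1 : (1 : ℝ) ≤ b := by exact_mod_cast hb
  have hKC : 0 ≤ K * C₀ * (Real.log β / β) := mul_nonneg (mul_nonneg hK.le hC₀0) hL0
  have hptV : ∀ V : GaugeConfig 4 (2 * ((2 * n + 2) * b + 1) + 1) G, kernelAction ρ β b n k₀ V ≤
      wilsonBoundaryAction ρ (rowRegion b n) (glueWith (rowRegion b n) (ζ₀ V)
        (twistΦ b (comb b ((2 * n + 2) * b + 1) k₀) (torusLift (2 * ((2 * n + 2) * b + 1) + 1) V))) +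
        K * C₀ * (Real.log β / β) * (b : ℝ) ^ 4 := fun V => by
    have h := hpt β hβ3 b V (ζ₀ V)
    have hc : K * (((rowRegion b n).card : ℝ) + (plaquettesTouching (rowRegion b n)).card + 1) * (Real.log β / β) ≤
        K * (C₀ * (b : ℝ) ^ 4) * (Real.log β / β) :=
      mul_le_mul_of_nonneg_right (mul_le_mul_of_nonneg_left (hC₀ b hb) hK.le) hL0
    have e : K * (C₀ * (b : ℝ) ^ 4) * (Real.log β / β) = K * C₀ * (Real.log β / β) * (b : ℝ) ^ 4 := by ring
    linarith [h, hc, e.le, e.ge]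
  have hintK : Integrable (kernelAction ρ β b n k₀) (wilsonMeasure (d := 4) (L := 2 * ((2 * n + 2) * b + 1) + 1) ρ β) :=
    integrable_of_continuous _ (continuous_kernelAction ρ hρ hρu β b n k₀)
  have hintA : Integrable (fun V => wilsonBoundaryAction ρ (rowRegion b n) (glueWith (rowRegion b n) (ζ₀ V)
        (twistΦ b (comb b ((2 * n + 2) * b + 1) k₀) (torusLift (2 * ((2 * n + 2) * b + 1) + 1) V))))
      (wilsonMeasure (d := 4) (L := 2 * ((2 * n + 2) * b + 1) + 1) ρ β) :=
    Integrable.of_bound hmeas.aestronglyMeasurable (2 * N * (plaquettesTouching (rowRegion b n)).card)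
      (ae_of_all _ fun V => by
        rw [Real.norm_eq_abs, abs_of_nonneg (wilsonBoundaryAction_nonneg ρ hρu _ _)]
        exact wilsonBoundaryAction_le_card ρ hρu _ _)
  have hintS : Integrable (fun V => wilsonBoundaryAction ρ (rowRegion b n) (glueWith (rowRegion b n) (ζ₀ V)
        (twistΦ b (comb b ((2 * n + 2) * b + 1) k₀) (torusLift (2 * ((2 * n + 2) * b + 1) + 1) V))) +
        K * C₀ * (Real.log β / β) * (b : ℝ) ^ 4) (wilsonMeasure (d := 4) (L := 2 * ((2 * n + 2) * b + 1) + 1) ρ β) :=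
    hintA.add (integrable_const _)
  have h45 : (b : ℝ) ^ 4 ≤ (b : ℝ) ^ 5 := pow_le_pow_right₀ hb1 (by norm_num)
  have hgrow := mul_le_mul_of_nonneg_left h45 hKC
  calc ∫ V, kernelAction ρ β b n k₀ V ∂(wilsonMeasure (d := 4) (L := 2 * ((2 * n + 2) * b + 1) + 1) ρ β)
      ≤ ∫ V, (wilsonBoundaryAction ρ (rowRegion b n) (glueWith (rowRegion b n) (ζ₀ V)
          (twistΦ b (comb b ((2 * n + 2) * b + 1) k₀) (torusLift (2 * ((2 * n + 2) * b + 1) + 1) V))) +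
          K * C₀ * (Real.log β / β) * (b : ℝ) ^ 4)
          ∂(wilsonMeasure (d := 4) (L := 2 * ((2 * n + 2) * b + 1) + 1) ρ β) :=
        integral_mono hintK hintS hptV
    _ = ∫ V, wilsonBoundaryAction ρ (rowRegion b n) (glueWith (rowRegion b n) (ζ₀ V)
          (twistΦ b (comb b ((2 * n + 2) * b + 1) k₀) (torusLift (2 * ((2 * n + 2) * b + 1) + 1) V)))
          ∂(wilsonMeasure (d := 4) (L := 2 * ((2 * n + 2) * b + 1) + 1) ρ β) +
          K * C₀ * (Real.log β / β) * (b : ℝ) ^ 4 := by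
        rw [integral_add hintA (integrable_const _), integral_const, probReal_univ, one_smul]
    _ ≤ C₁ * (b : ℝ) ^ 5 * (Real.log β / β) + K * C₀ * (Real.log β / β) * (b : ℝ) ^ 5 := add_le_add hint hgrow
    _ = (C₁ + K * C₀) * (b : ℝ) ^ 5 * (Real.log β / β) := by ring




end RefAssembly

/-! ## §4k (PROVED; rev 10) Region counts: `#Λ_b + #touching(Λ_b) + 1 ≤ C₀(n) b⁴` (R3) -/

section Counts

/-- A cell of the standard mesh-`b` frame has at most `64 b⁴` edges. -/
theorem card_cellEdges_stdFrame_le (b : ℕ) (y : Fin 4 → ℤ) : (cellEdges (stdFrame b) y).card ≤ 64 * b ^ 4 := by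
  have hwid : ∀ i ∈ (Finset.univ : Finset (Fin 4)),
      (Finset.Ico (stdFrame b i (y i)) (stdFrame b i (y i + 1))).card ≤ 2 * b := by
    intro i _
    rw [Int.card_Ico]
    have h := (stdFrame_admissible b i (y i)).2
    omega
  rw [Summit.QuantumFields.YangMills.Cruxes.IR.Tempered.cellEdges, Finset.card_product, Fintype.card_piFinset,
    Finset.card_univ, Fintype.card_fin]
  calc (∏ i : Fin 4, (Finset.Ico (stdFrame b i (y i)) (stdFrame b i (y i + 1))).card) * 4
      ≤ (∏ _i : Fin 4, 2 * b) * 4 :=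
        Nat.mul_le_mul_right 4 (Finset.prod_le_prod (fun i _ => Nat.zero_le _) hwid)
    _ = 64 * b ^ 4 := by rw [Finset.prod_const, Finset.card_univ, Fintype.card_fin]; ring

/-- `#rowRegion b n ≤ #rowCells n · 64 b⁴`. -/
theorem card_rowRegion_le (b n : ℕ) : (rowRegion b n).card ≤ (rowCells n).card * (64 * b ^ 4) := by
  unfold rowRegion Summit.QuantumFields.YangMills.Cruxes.IR.Tempered.regionEdges
  calc ((rowCells n).biUnion (cellEdges (stdFrame b))).card ≤ ∑ y ∈ rowCells n, (cellEdges (stdFrame b) y).card :=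
        Finset.card_biUnion_le
    _ ≤ (rowCells n).card • (64 * b ^ 4) :=
        Finset.sum_le_card_nsmul _ _ _ fun y _ => card_cellEdges_stdFrame_le b y
    _ = (rowCells n).card * (64 * b ^ 4) := smul_eq_mul _ _

/-- **Region counts (PROVED):** `#Λ_b + #touching(Λ_b) + 1 ≤ C₀(n) b⁴` for `b ≥ 1`. -/
theorem rowRegion_counts (n : ℕ) : ∃ C₀ : ℝ, ∀ b : ℕ, 1 ≤ b →
    ((rowRegion b n).card : ℝ) + (plaquettesTouching (rowRegion b n)).card + 1 ≤ C₀ * (b : ℝ) ^ 4 := by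
  refine ⟨(rowCells n).card * 64 * (1 + (1 + 4) * Fintype.card {p : Fin 4 × Fin 4 // p.1 < p.2}) + 1,
    fun b hb => ?_⟩
  have h1 : ((rowRegion b n).card : ℝ) ≤ (rowCells n).card * (64 * (b : ℝ) ^ 4) := by
    exact_mod_cast card_rowRegion_le b n
  have h2 : ((plaquettesTouching (rowRegion b n)).card : ℝ) ≤
      (1 + 4) * Fintype.card {p : Fin 4 × Fin 4 // p.1 < p.2} * (rowRegion b n).card := by
    exact_mod_cast card_plaquettesTouching_le (rowRegion b n)
  have hb4 : (1 : ℝ) ≤ (b : ℝ) ^ 4 := one_le_pow₀ (by exact_mod_cast hb)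
  have hP : (0 : ℝ) ≤ Fintype.card {p : Fin 4 × Fin 4 // p.1 < p.2} := by positivity
  have h2' : ((plaquettesTouching (rowRegion b n)).card : ℝ) ≤
      (1 + 4) * Fintype.card {p : Fin 4 × Fin 4 // p.1 < p.2} * ((rowCells n).card * (64 * (b : ℝ) ^ 4)) :=
    h2.trans (mul_le_mul_of_nonneg_left h1 (by positivity))
  have e : ((rowCells n).card * 64 * (1 + (1 + 4) * Fintype.card {p : Fin 4 × Fin 4 // p.1 < p.2}) + 1) * (b : ℝ) ^ 4
      = (rowCells n).card * (64 * (b : ℝ) ^ 4) +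
        (1 + 4) * Fintype.card {p : Fin 4 × Fin 4 // p.1 < p.2} * ((rowCells n).card * (64 * (b : ℝ) ^ 4)) +
        (b : ℝ) ^ 4 := by ring
  rw [e]
  linarith

end Counts

end Summit.QuantumFields.YangMills.Cruxes.IR.RowFloorPoly

end
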